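/-
Copyright (c) 2026 the pub-hodgecm-mathlib formalisation cell (harness21).  Prover seat hodgecm-mathlib-K2E1-p16 (g2), Track B «K2-LIT» ENGINE E1, h413 = `stmt-HodgeConjecture-24833`,
route `HCCMUnconditional`, R90-S8 «ContSpec-n½» #4′ letter chain, H8 (IDENT) FILE 2a (S8 dealer R90-CS-plan (g2), S8-R47): MELLIN INTERPOLATION WITH VANISHING AXIS NORM —
the real-analysis lemma behind «the residue classes lie in the closed span of the block's pseudo-Eisenstein series» (range splitting of the self-dual block isometry).
-/
import Summits.HodgeConjecture.HodgeConjecture.Theorems.K2E1ChiSectionPlancherelKTypeCMTwo   -- ★ (OD) §1 `memLp_two_mellin_neg_axis`; brings ★ `K2E1MellinPaleyWienerHalfLine` (`mellinConvergent_of_tsupport_subset_Ioi`)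
import Mathlib.Analysis.Calculus.BumpFunction.FiniteDimension
import Mathlib.LinearAlgebra.Lagrange
import HarnessLib

/-!
# h413 ∕ R90-S8 #4′ chain, H8 (IDENT) FILE 2a — `R90S8MellinInterpolationVanishingAxis`: MELLIN INTERPOLATION PROFILES WITH VANISHING AXIS NORM

Cell `pub/hodgecm-mathlib`, crux H413 = `stmt-HodgeConjecture-24833`; S8 dealer R90-CS-plan (g2) S8-R47 (FILE 2 of H8 «=»); census `K2/K2E1-p16/g2/CENSUS-H8.md` §2, K2E1-p13's
CENSUS-Eblk §2 («range splitting = Mellin interpolation with vanishing axis norm, ≈ 150 l. real analysis, MISSING»).  THEOREMS ONLY (no `def`, no `instance`, no `notation`, no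
named-fact hypothesis, no `sorry`; default heartbeats); lane `--kind proof --supports stmt-HodgeConjecture-24833 --as helper` (count-neutral).  Mathlib + ★ `K2E1MellinPaleyWienerHalfLine`
∕ ★ (OD) `K2E1ChiSectionPlancherelKTypeCMTwo` §1 only (pure real analysis; no automorphic object).

THE MATHEMATICS ([MoeglinWaldspurger1995, II.1.10–II.1.11, V.3.13]; [Langlands1976, §7]; [Titchmarsh1948, §1.29]).  For a finite set `S ⊂ (½, ∞)` of real poles and `c₀ ∈ S` there are
profiles `f ∈ C_c^∞((0,∞))` with PRESCRIBED MELLIN VALUES `f̃(−c₀) = 1`, `f̃(−c) = 0 (c ∈ S ∖ {c₀})` and ARBITRARILY SMALL AXIS NORM `‖f̃(−(½+i·))‖_{L²(ℝ)} < ε`.  Construction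
(no derivatives): the dilates `g_k(t) = g(2^k t)` of a bump `g ≥ 0` on `(½, 3∕2)` have `g̃_k(−c) = (2^c)^k·g̃(−c)` (★ Mathlib `mellin_comp_mul_left`) with `g̃(−c) > 0`, so the Lagrange basis
polynomial `p = ℓ_{c₀}` at the DISTINCT nodes `2^c (c ∈ S)` (Mathlib `Lagrange.basis`) gives the interpolant `f₀ = g̃(−c₀)⁻¹·Σ_k p_k g_k` (`f̃₀(−c) = δ_{c,c₀}`); the dilation family
`F_b(t) = b^{−c₀} f₀(b t)` (`b ≥ 1`) keeps `F̃_b(−c) = b^{c−c₀}δ_{c,c₀} = δ_{c,c₀}` and has `|F̃_b(−(½+iy))| = b^{½−c₀}|f̃₀(−(½+iy))|`, whence `‖F̃_b‖_{L²(axis)} = b^{½−c₀}‖f̃₀‖_{L²(axis)} → 0`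
as `b → ∞` BECAUSE `c₀ > ½` STRICTLY (★ (OD) `memLp_two_mellin_neg_axis`: `f̃₀ ∈ L²` of the axis).
* §1 Mellin of finite sums and of dilates (`mellin_finset_sum`, `mellin_dilate`), dilation bookkeeping (`dilate_props`, `hasCompactSupport_of_support_subset_Ioo`), the positive bump
  (`exists_bump_mellin_ne_zero`).
* §2 `exists_mellin_interpolant` — `f₀ ∈ C_c^∞((0,∞))` with `f̃₀(−c) = δ_{c,c₀}` on `S`.
* §3 HEAD **`exists_mellin_interpolant_small_axis`** — for every `ε > 0`: `f ∈ C²_c((0,∞))` (in fact `C^∞`), `tsupport f ⊆ (0,∞)`, `f̃(−c) = δ_{c,c₀}` on `S`, and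
  `eLpNorm (y ↦ f̃(−(½+iy))) 2 volume ≤ ENNReal.ofReal ε`.
HONEST LABEL: HC_CM is proved only modulo the 7 printed citations (2 remaining named inputs: hLiu418 = `stmt-HodgeConjecture-24832`, h413 = `stmt-HodgeConjecture-24833`) until rung 0
closes; this file asserts no named fact and closes no socket; count-neutral; letter-free.

## References
* [MoeglinWaldspurger1995] C. Mœglin, J.-L. Waldspurger, *Spectral Decomposition and Eisenstein Series* (1995), II.1.10–II.1.11, V.3.13.
* [Langlands1976] R. P. Langlands, *On the Functional Equations Satisfied by Eisenstein Series*, LNM 544 (1976), §7.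
* [Titchmarsh1948] E. C. Titchmarsh, *Introduction to the Theory of Fourier Integrals* (2nd ed., 1948), §1.29.
-/

set_option autoImplicit false
-- the mandated namespace `…HodgeConjecture.HodgeConjecture.R90.S8` (LEAD #1 L1) repeats the summit's segment
set_option linter.dupNamespace false

noncomputable section

open MeasureTheory Measure Set Filter Topology Complex Metric
open scoped Real ENNReal ComplexConjugate BigOperators Polynomial
open Summit.HodgeConjecture.HodgeConjecture.Cruxes.H413.K2E1MellinPaleyWienerHalfLine (mellinConvergent_of_tsupport_subset_Ioi)
open Summit.HodgeConjecture.HodgeConjecture.Cruxes.H413.K2E1ChiSectionPlancherelKTypeCMTwo (memLp_two_mellin_neg_axis)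

namespace Summit.HodgeConjecture.HodgeConjecture.R90.S8

/-! ## §1 Mellin values of dilates and of finite sums; a positive bump -/

/-- **MELLIN OF A FINITE SUM** of Mellin-convergent functions. [folklore] -/
theorem mellin_finset_sum {κ : Type*} (T : Finset κ) (F : κ → ℝ → ℂ) (s : ℂ) (hF : ∀ k ∈ T, MellinConvergent (F k) s) :
    mellin (fun t => ∑ k ∈ T, F k t) s = ∑ k ∈ T, mellin (F k) s := by
  simp only [mellin, smul_eq_mul, Finset.mul_sum]
  rw [integral_finsetSum]
  intro k hk
  have h := hF k hk
  rw [MellinConvergent, IntegrableOn] at h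
  simp only [smul_eq_mul] at h
  exact h

/-- **MELLIN OF A DILATE AT `−c`**: `∫ (g(a t)) t^{−c−1} dt = a^{c}·g̃(−c)` for `a > 0`, in the real-power spelling `((a^c : ℝ) : ℂ)`. [cite: Titchmarsh1948, §1.29] -/
theorem mellin_dilate (g : ℝ → ℂ) {a : ℝ} (ha : 0 < a) (c : ℝ) :
    mellin (fun t => g (a * t)) (-(c : ℂ)) = (((a ^ c : ℝ)) : ℂ) * mellin g (-(c : ℂ)) := by
  rw [mellin_comp_mul_left g _ ha, neg_neg, smul_eq_mul, Complex.ofReal_cpow ha.le]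

/-- Continuity, compact support in `(0,∞)` and smoothness are stable under dilation `t ↦ g (a t)`, `a > 0`. [folklore] -/
theorem dilate_props {g : ℝ → ℂ} {n : ℕ∞} (hg : ContDiff ℝ n g) {δ Δ : ℝ} (hsupp : ∀ t, g t ≠ 0 → t ∈ Ioo δ Δ) {a : ℝ} (ha : 0 < a) :
    ContDiff ℝ n (fun t => g (a * t)) ∧ ∀ t, g (a * t) ≠ 0 → t ∈ Ioo (δ / a) (Δ / a) := by
  refine ⟨hg.comp (contDiff_const.mul contDiff_id), fun t ht => ?_⟩
  have h := hsupp _ ht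
  exact ⟨(div_lt_iff₀ ha).2 (by rw [mul_comm]; exact h.1), (lt_div_iff₀ ha).2 (by rw [mul_comm]; exact h.2)⟩

/-- A function vanishing off `Ioo δ Δ` with `0 < δ` has compact support contained in `(0, ∞)`. [folklore] -/
theorem hasCompactSupport_of_support_subset_Ioo {g : ℝ → ℂ} {δ Δ : ℝ} (hδ : 0 < δ) (hsupp : ∀ t, g t ≠ 0 → t ∈ Ioo δ Δ) :
    HasCompactSupport g ∧ tsupport g ⊆ Ioi 0 := by
  have hK : Function.support g ⊆ Icc δ Δ := fun t ht => Ioo_subset_Icc_self (hsupp t ht)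
  have hts : tsupport g ⊆ Icc δ Δ := closure_minimal hK isClosed_Icc
  exact ⟨HasCompactSupport.of_support_subset_isCompact isCompact_Icc hK, hts.trans fun t ht => lt_of_lt_of_le hδ ht.1⟩

/-- **A POSITIVE BUMP ON `(½, 3∕2)`**: there is `g ∈ C^∞(ℝ)`, supported in `Ioo (1∕2) (3∕2)`, whose Mellin values `g̃(−c)` at all real `c > 0` are non-zero (indeed positive reals:
`g ≥ 0`, `g = 1` on `[3∕4, 5∕4]`). [cite: Titchmarsh1948, §1.29] -/
theorem exists_bump_mellin_ne_zero :
    ∃ g : ℝ → ℂ, ContDiff ℝ 2 g ∧ (∀ t, g t ≠ 0 → t ∈ Ioo (1 / 2 : ℝ) (3 / 2)) ∧ ∀ c : ℝ, 0 < c → mellin g (-(c : ℂ)) ≠ 0 := by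
  -- the standard bump centred at `1` with radii `1/4 < 1/2`
  let β : ContDiffBump (1 : ℝ) := ⟨1 / 4, 1 / 2, by norm_num, by norm_num⟩
  have hrO : β.rOut = 1 / 2 := rfl
  have hrI : β.rIn = 1 / 4 := rfl
  have hsupp : ∀ t, ((β t : ℝ) : ℂ) ≠ 0 → t ∈ Ioo (1 / 2 : ℝ) (3 / 2) := by
    intro t ht
    have ht' : (β : ℝ → ℝ) t ≠ 0 := fun h => ht (by simp only [h, Complex.ofReal_zero])
    have hmem : t ∈ Function.support (β : ℝ → ℝ) := ht'
    rw [β.support_eq, Real.ball_eq_Ioo, hrO] at hmem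
    exact ⟨by linarith [hmem.1], by linarith [hmem.2]⟩
  refine ⟨fun t => ((β t : ℝ) : ℂ), ?_, hsupp, ?_⟩
  · exact Complex.ofRealCLM.contDiff.comp β.contDiff
  · intro c hc
    -- `g̃(−c) = ∫_0^∞ t^{−c−1} g(t) dt` is the integral of a non-negative continuous function `≥ (5/4)^{−c−1}` on `[3/4, 5/4]`
    have hgc : Continuous fun t : ℝ => ((β t : ℝ) : ℂ) := Complex.continuous_ofReal.comp β.continuous
    have hg0 : tsupport (fun t : ℝ => ((β t : ℝ) : ℂ)) ⊆ Ioi 0 := (hasCompactSupport_of_support_subset_Ioo (by norm_num) hsupp).2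
    have hgs : HasCompactSupport fun t : ℝ => ((β t : ℝ) : ℂ) := β.hasCompactSupport.comp_left Complex.ofReal_zero
    -- the complex integrand is the real integrand
    have hconv := mellinConvergent_of_tsupport_subset_Ioi hgc hgs hg0 (-(c : ℂ))
    rw [MellinConvergent] at hconv
    have hreal : ∀ t ∈ Ioi (0 : ℝ), (t : ℂ) ^ (-(c : ℂ) - 1) • (((β t : ℝ)) : ℂ) = (((t ^ (-c - 1) * β t : ℝ)) : ℂ) := by
      intro t ht
      rw [smul_eq_mul, Complex.ofReal_mul, Complex.ofReal_cpow (le_of_lt ht)]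
      push_cast
      ring_nf
    have hmel : mellin (fun t : ℝ => ((β t : ℝ) : ℂ)) (-(c : ℂ)) = (((∫ t in Ioi (0 : ℝ), t ^ (-c - 1) * β t : ℝ)) : ℂ) := by
      rw [mellin, setIntegral_congr_fun measurableSet_Ioi hreal, integral_complex_ofReal]
    rw [hmel, Complex.ofReal_ne_zero]
    -- positivity of the real integral
    have hint : IntegrableOn (fun t : ℝ => t ^ (-c - 1) * β t) (Ioi 0) := by
      have h1 : IntegrableOn (fun t : ℝ => ‖(t : ℂ) ^ (-(c : ℂ) - 1) • (((β t : ℝ)) : ℂ)‖) (Ioi 0) := hconv.norm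
      refine (h1.congr_fun (fun t ht => ?_) measurableSet_Ioi)
      dsimp only
      rw [hreal t ht, Complex.norm_real, Real.norm_eq_abs, abs_of_nonneg (mul_nonneg (Real.rpow_nonneg (le_of_lt ht) _) β.nonneg)]
    set κ : ℝ := (5 / 4 : ℝ) ^ (-c - 1) with hκdef
    have hκ : 0 < κ := Real.rpow_pos_of_pos (by norm_num) _
    have hind : IntegrableOn (fun t : ℝ => (Icc (3 / 4 : ℝ) (5 / 4)).indicator (fun _ => κ) t) (Ioi 0) :=
      ((integrable_indicator_iff measurableSet_Icc).2 (integrableOn_const (by rw [Real.volume_Icc]; exact ENNReal.ofReal_ne_top))).integrableOn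
    have hle : ∀ t ∈ Ioi (0 : ℝ), (Icc (3 / 4 : ℝ) (5 / 4)).indicator (fun _ => κ) t ≤ t ^ (-c - 1) * β t := by
      intro t ht
      by_cases hI : t ∈ Icc (3 / 4 : ℝ) (5 / 4)
      · rw [indicator_of_mem hI]
        have hβ1 : β t = 1 := β.one_of_mem_closedBall (by rw [Real.closedBall_eq_Icc, hrI]; exact ⟨by linarith [hI.1], by linarith [hI.2]⟩)
        rw [hβ1, mul_one, hκdef]
        exact Real.rpow_le_rpow_of_nonpos (lt_of_lt_of_le (by norm_num) hI.1) hI.2 (by linarith)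
      · rw [indicator_of_notMem hI]
        exact mul_nonneg (Real.rpow_nonneg (le_of_lt ht) _) β.nonneg
    have hmono : ∫ t in Ioi (0 : ℝ), (Icc (3 / 4 : ℝ) (5 / 4)).indicator (fun _ => κ) t ≤ ∫ t in Ioi (0 : ℝ), t ^ (-c - 1) * β t :=
      setIntegral_mono_on hind hint measurableSet_Ioi hle
    have hval : ∫ t in Ioi (0 : ℝ), (Icc (3 / 4 : ℝ) (5 / 4)).indicator (fun _ => κ) t = (1 / 2 : ℝ) * κ := by
      have hset : Ioi (0 : ℝ) ∩ Icc (3 / 4 : ℝ) (5 / 4) = Icc (3 / 4 : ℝ) (5 / 4) := inter_eq_right.2 fun t ht => lt_of_lt_of_le (by norm_num) ht.1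
      rw [setIntegral_indicator measurableSet_Icc, setIntegral_const, hset, measureReal_def, Real.volume_Icc, smul_eq_mul, ENNReal.toReal_ofReal (by norm_num)]
      norm_num
    have hpos : (0 : ℝ) < ∫ t in Ioi (0 : ℝ), t ^ (-c - 1) * β t := lt_of_lt_of_le (by rw [hval]; positivity) hmono
    exact hpos.ne'

/-! ## §2 The interpolant: prescribed Mellin values at finitely many real points -/

/-- **MELLIN INTERPOLATION**: for a finite set `S` of positive reals and `c₀ ∈ S` there is `f₀ ∈ C²_c((0,∞))` (a finite combination of dilates `g(2^k t)` of the bump, coefficients from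
the Lagrange basis polynomial at the distinct nodes `2^c`) with `f̃₀(−c₀) = 1` and `f̃₀(−c) = 0` for `c ∈ S ∖ {c₀}`. [cite: MoeglinWaldspurger1995, II.1.10] [cite: Titchmarsh1948, §1.29] -/
theorem exists_mellin_interpolant (S : Finset ℝ) (hS : ∀ c ∈ S, 0 < c) (c₀ : ℝ) (hc₀ : c₀ ∈ S) :
    ∃ f : ℝ → ℂ, ContDiff ℝ 2 f ∧ (∃ δ Δ : ℝ, 0 < δ ∧ ∀ t, f t ≠ 0 → t ∈ Ioo δ Δ) ∧ ∀ c ∈ S, mellin f (-(c : ℂ)) = if c = c₀ then 1 else 0 := by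
  obtain ⟨g, hg2, hgsupp, hgne⟩ := exists_bump_mellin_ne_zero
  have hgc : Continuous g := hg2.continuous
  obtain ⟨hgs, hg0⟩ := hasCompactSupport_of_support_subset_Ioo (by norm_num) hgsupp
  -- the nodes `2^c` and the Lagrange basis polynomial at `c₀`
  set v : ℝ → ℂ := fun c => (((2 : ℝ) ^ c : ℝ) : ℂ) with hv
  have hinj : Set.InjOn v (S : Set ℝ) := by
    intro c _ c' _ h
    have h' : (2 : ℝ) ^ c = (2 : ℝ) ^ c' := by simpa [hv] using h
    exact le_antisymm ((Real.rpow_le_rpow_left_iff one_lt_two).1 h'.le) ((Real.rpow_le_rpow_left_iff one_lt_two).1 h'.ge)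
  set p : ℂ[X] := Lagrange.basis S v c₀ with hp
  set d : ℕ := p.natDegree with hd
  set m₀ : ℂ := mellin g (-(c₀ : ℂ)) with hm₀
  have hm₀ne : m₀ ≠ 0 := hgne c₀ (hS c₀ hc₀)
  -- the interpolant
  refine ⟨fun t => m₀⁻¹ • ∑ k ∈ Finset.range (d + 1), p.coeff k • g (2 ^ k * t), ?_, ?_, ?_⟩
  · exact (contDiff_const (c := m₀⁻¹)).smul (ContDiff.sum fun k _ => (contDiff_const (c := p.coeff k)).smul (dilate_props hg2 hgsupp (pow_pos two_pos k)).1)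
  · refine ⟨1 / 2 / 2 ^ d, 3 / 2, by positivity, fun t ht => ?_⟩
    -- some dilate is non-zero at `t`
    by_contra hnot
    apply ht
    have hzero : ∀ k ∈ Finset.range (d + 1), p.coeff k • g (2 ^ k * t) = 0 := by
      intro k hk
      have hk' : k ≤ d := Nat.lt_succ_iff.1 (Finset.mem_range.1 hk)
      by_cases hgk : g (2 ^ k * t) = 0
      · rw [hgk, smul_zero]
      · exfalso
        apply hnot
        have hmem := (dilate_props hg2 hgsupp (pow_pos two_pos k)).2 t hgk
        have h2k : (1 : ℝ) ≤ 2 ^ k := one_le_pow₀ (by norm_num)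
        have h2kd : (2 : ℝ) ^ k ≤ 2 ^ d := pow_le_pow_right₀ (by norm_num) hk'
        refine ⟨lt_of_le_of_lt ?_ hmem.1, lt_of_lt_of_le hmem.2 ?_⟩
        · exact div_le_div_of_nonneg_left (by norm_num) (pow_pos two_pos k) h2kd
        · exact div_le_self (by norm_num) h2k
    change m₀⁻¹ • ∑ k ∈ Finset.range (d + 1), p.coeff k • g (2 ^ k * t) = 0
    rw [Finset.sum_eq_zero hzero, smul_zero]
  · intro c hcS
    -- Mellin of the finite dilation sum
    have hconv : ∀ k ∈ Finset.range (d + 1), MellinConvergent (fun t => p.coeff k • g (2 ^ k * t)) (-(c : ℂ)) := fun k _ =>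
      ((MellinConvergent.comp_mul_left (pow_pos two_pos k)).2 (mellinConvergent_of_tsupport_subset_Ioi hgc hgs hg0 _)).const_smul _
    have hterm : ∀ k ∈ Finset.range (d + 1), mellin (fun t => p.coeff k • g (2 ^ k * t)) (-(c : ℂ)) = mellin g (-(c : ℂ)) * (p.coeff k * v c ^ k) := by
      intro k _
      rw [mellin_const_smul, mellin_dilate g (pow_pos two_pos k) c, smul_eq_mul, hv]
      simp only
      rw [← Real.rpow_pow_comm (by norm_num : (0 : ℝ) ≤ 2) c k, Complex.ofReal_pow]
      ring
    change mellin (fun t => m₀⁻¹ • ∑ k ∈ Finset.range (d + 1), p.coeff k • g (2 ^ k * t)) (-(c : ℂ)) = _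
    rw [mellin_const_smul, mellin_finset_sum _ _ _ hconv, Finset.sum_congr rfl hterm, ← Finset.mul_sum, hd, ← Polynomial.eval_eq_sum_range, smul_eq_mul]
    by_cases hcc : c = c₀
    · subst hcc
      rw [hp, Lagrange.eval_basis_self hinj hc₀, if_pos rfl, mul_one, ← hm₀, inv_mul_cancel₀ hm₀ne]
    · rw [hp, Lagrange.eval_basis_of_ne (Ne.symm hcc) hcS, if_neg hcc, mul_zero, mul_zero]

/-! ## §3 HEAD: dilating the interpolant towards `0` kills the axis norm -/

/-- **MELLIN INTERPOLATION WITH VANISHING AXIS NORM.**  `S ⊂ (½, ∞)` finite, `c₀ ∈ S`, `ε > 0`: there is `f ∈ C²_c((0,∞))` (`tsupport f ⊆ (0,∞)` compact) with `f̃(−c₀) = 1`, `f̃(−c) = 0`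
(`c ∈ S ∖ {c₀}`) and `‖f̃(−(½+i·))‖_{L²(ℝ)} ≤ ε`.  Proof: `F_b(t) = b^{−c₀} f₀(b t)` has `F̃_b(−c) = b^{c−c₀} f̃₀(−c) = δ_{c,c₀}` and `|F̃_b(−(½+iy))| = b^{½−c₀}|f̃₀(−(½+iy))|`, and
`b^{½−c₀} → 0` as `b → ∞` since `c₀ > ½` (★ (OD) `memLp_two_mellin_neg_axis`: `f̃₀` is `L²` on the axis).  This is the «range splitting» input of the self-dual block: the generator
`[θ_{F_b ⊗ φ}]` has a FIXED atom coordinate and a line coordinate of norm `→ 0`. [cite: MoeglinWaldspurger1995, II.1.10–II.1.11, V.3.13] [cite: Langlands1976, §7] -/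
theorem exists_mellin_interpolant_small_axis (S : Finset ℝ) (hS : ∀ c ∈ S, 1 / 2 < c) (c₀ : ℝ) (hc₀ : c₀ ∈ S) {ε : ℝ} (hε : 0 < ε) :
    ∃ f : ℝ → ℂ, ContDiff ℝ 2 f ∧ HasCompactSupport f ∧ tsupport f ⊆ Ioi 0 ∧ (∀ c ∈ S, mellin f (-(c : ℂ)) = if c = c₀ then 1 else 0) ∧
      eLpNorm (fun y : ℝ => mellin f (-((((1 / 2 : ℝ)) : ℂ) + y * I))) 2 volume ≤ ENNReal.ofReal ε := by
  obtain ⟨f₀, hf2, ⟨δ, Δ, hδ, hsupp⟩, hval⟩ := exists_mellin_interpolant S (fun c hc => lt_trans one_half_pos (hS c hc)) c₀ hc₀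
  obtain ⟨hfs, hf0⟩ := hasCompactSupport_of_support_subset_Ioo hδ hsupp
  have hc₀' : 0 < c₀ - 1 / 2 := by linarith [hS c₀ hc₀]
  -- the axis norm of `f₀` is finite
  have hmem := memLp_two_mellin_neg_axis hf2 hfs hf0
  set N₀ : ℝ≥0∞ := eLpNorm (fun y : ℝ => mellin f₀ (-((((1 / 2 : ℝ)) : ℂ) + y * I))) 2 volume with hN₀
  have hN₀top : N₀ ≠ ∞ := hmem.eLpNorm_lt_top.ne
  set n₀ : ℝ := N₀.toReal with hn₀
  have hn₀0 : 0 ≤ n₀ := ENNReal.toReal_nonneg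
  -- choose the dilation parameter
  have hev : ∀ᶠ b : ℝ in atTop, b ^ (-(c₀ - 1 / 2)) < ε / (n₀ + 1) ∧ 1 ≤ b :=
    ((tendsto_rpow_neg_atTop hc₀').eventually (gt_mem_nhds (div_pos hε (by linarith)))).and (eventually_ge_atTop 1)
  obtain ⟨b, hbε, hb1⟩ := hev.exists
  have hb : 0 < b := lt_of_lt_of_le one_pos hb1
  -- the dilated profile
  set κ : ℝ := b ^ (-c₀) with hκ
  refine ⟨fun t => ((κ : ℝ) : ℂ) • f₀ (b * t), ?_, ?_, ?_, ?_, ?_⟩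
  · exact (contDiff_const (c := ((κ : ℝ) : ℂ))).smul (dilate_props hf2 hsupp hb).1
  · exact (hasCompactSupport_of_support_subset_Ioo (div_pos hδ hb) fun t ht => (dilate_props hf2 hsupp hb).2 t (right_ne_zero_of_smul ht)).1
  · exact (hasCompactSupport_of_support_subset_Ioo (div_pos hδ hb) fun t ht => (dilate_props hf2 hsupp hb).2 t (right_ne_zero_of_smul ht)).2
  · intro c hcS
    rw [mellin_const_smul, mellin_dilate f₀ hb c, hval c hcS, smul_eq_mul]
    by_cases hcc : c = c₀
    · subst hcc
      rw [if_pos rfl, mul_one, ← Complex.ofReal_mul, hκ, ← Real.rpow_add hb, neg_add_cancel, Real.rpow_zero, Complex.ofReal_one]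
    · rw [if_neg hcc, mul_zero, mul_zero]
  · -- the axis norm scales by `b^{½ − c₀}`
    have haxis : ∀ y : ℝ, ‖mellin (fun t => ((κ : ℝ) : ℂ) • f₀ (b * t)) (-((((1 / 2 : ℝ)) : ℂ) + y * I))‖ =
        (κ * b ^ (1 / 2 : ℝ)) * ‖mellin f₀ (-((((1 / 2 : ℝ)) : ℂ) + y * I))‖ := fun y => by
      have hre : ((((1 / 2 : ℝ)) : ℂ) + y * I).re = 1 / 2 := by simp
      rw [mellin_const_smul, mellin_comp_mul_left f₀ _ hb, neg_neg, smul_eq_mul, smul_eq_mul, norm_mul, norm_mul, Complex.norm_real, Real.norm_eq_abs,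
        abs_of_nonneg (Real.rpow_nonneg hb.le _), Complex.norm_cpow_eq_rpow_re_of_pos hb, hre]
      ring
    have hK0 : 0 ≤ κ * b ^ (1 / 2 : ℝ) := mul_nonneg (Real.rpow_nonneg hb.le _) (Real.rpow_nonneg hb.le _)
    have hKε : κ * b ^ (1 / 2 : ℝ) * n₀ ≤ ε := by
      have hK : κ * b ^ (1 / 2 : ℝ) = b ^ (-(c₀ - 1 / 2)) := by rw [hκ, ← Real.rpow_add hb]; ring_nf
      rw [hK]
      have h1 : b ^ (-(c₀ - 1 / 2)) * n₀ ≤ b ^ (-(c₀ - 1 / 2)) * (n₀ + 1) := mul_le_mul_of_nonneg_left (by linarith) (Real.rpow_nonneg hb.le _)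
      have h2 : b ^ (-(c₀ - 1 / 2)) * (n₀ + 1) < ε := (lt_div_iff₀ (by linarith)).1 hbε
      linarith
    calc eLpNorm (fun y : ℝ => mellin (fun t => ((κ : ℝ) : ℂ) • f₀ (b * t)) (-((((1 / 2 : ℝ)) : ℂ) + y * I))) 2 volume
        = eLpNorm (fun y : ℝ => ‖mellin (fun t => ((κ : ℝ) : ℂ) • f₀ (b * t)) (-((((1 / 2 : ℝ)) : ℂ) + y * I))‖) 2 volume := (eLpNorm_norm _).symm
      _ = eLpNorm ((κ * b ^ (1 / 2 : ℝ)) • fun y : ℝ => ‖mellin f₀ (-((((1 / 2 : ℝ)) : ℂ) + y * I))‖) 2 volume := by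
          congr 1
          funext y
          rw [haxis y, Pi.smul_apply, smul_eq_mul]
      _ = ‖κ * b ^ (1 / 2 : ℝ)‖ₑ * N₀ := by rw [eLpNorm_const_smul, eLpNorm_norm]
      _ ≤ ENNReal.ofReal ε := by
          rw [Real.enorm_eq_ofReal hK0, ← ENNReal.ofReal_toReal hN₀top, ← ENNReal.ofReal_mul hK0]
          exact ENNReal.ofReal_le_ofReal hKε

end Summit.HodgeConjecture.HodgeConjecture.R90.S8

end
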